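import Summits.CriticalPhenomena.CardyFormulaZ2.Theses.CardyBoundaryCoulombGas
import Summits.CriticalPhenomena.CardyFormulaZ2.Theorems.CardyBoundaryCoulombGasStripClusterRatesRelaxationUpperSpectral
import Summits.CriticalPhenomena.CardyFormulaZ2.Theorems.CardyBoundaryCoulombGasStripClusterRatesRelaxationUpperChain
import Summits.CriticalPhenomena.CardyFormulaZ2.Theorems.CardyBoundaryCoulombGasStripClusterRatesIterateAverage
import Literature.Probability.LatticeModels.RowStatePlanar
import Literature.Probability.Percolation.LatticeSymmetry

/-!
# Stub `stub_relaxationUpper` (S2a) of line `two-cluster-rate-is-stationary-gap`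
# (crux `CardyBoundaryCoulombGas.StripClusterRates`, stmt-CriticalPhenomena-13878)

**S2a · RELAXATION UPPER.** For every width `n ≥ 1` the UNMARKED block (`⋆` joined to no site) of
the planar `⋆`-chain `planarTransfer (Finset.Icc 0 n)` has a second-largest eigenvalue modulus
`s` — some unmarked eigenpair `(μ, v)` with `μ ≠ 1` has `‖μ‖ = s` and every unmarked eigenpair with
`μ ≠ 1` has `‖μ‖ ≤ s` — and the disagreement `dis n m` of the monotone grand coupling started from
ALLJOINED and from FREE satisfies `dis n m ≤ C_{s'} s'^m` for every `s' > s`.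

Assembly of the landed helpers:
* `…RelaxationUpperSpectral` (`s2a_stochastic_relaxation_of`): for a finite stochastic matrix with a
  column charged by every row, the eigenvalues `≠ 1` form a finite nonempty set (eigenvalue `1` is
  simple with no Jordan block: maximum principle + bounded powers; invariant complement
  `range (U - 1)`), and Gelfand's formula on that complement gives
  `(U^m g)(a) - (U^m g)(b) ≤ K_g s'^m`;
* `…RelaxationUpperChain`: the unmarked block of `planarTransfer S` is stochastic, every row
  charges `free` (all bonds closed), the same-bonds coupling is monotone, and the disagreement count
  is dominated by the pair functionals `1{y ∼ y'}`;
* `…IterateAverage` (`s1_pow_planarTransfer_mulVec`, landed by the S1' worker of the line):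
  "matrix power = normalised count over bond words" for `planarTransfer S`;
* here: the reduction of `T^m` on unmarked rows to the
  unmarked block (`s2a_pow_mulVec_block`), `alljoined ≠ free` for `n ≥ 1`, the translation
  between the skeleton's inlined "unmarked eigenpairs" and eigenpairs of the block, and the sum over
  the `(n+1)²` site pairs.

Sources: Levin–Peres–Wilmer (2009) §12.2, Cor. 12.6, §5; Bondesan–Jacobsen–Saleur (2013) §2;
Gelfand's formula (Mathlib `spectrum.pow_nnnorm_pow_one_div_tendsto_nhds_spectralRadius`).
-/

noncomputable section

namespace Summit.CriticalPhenomena.CardyFormulaZ2.Cruxes.StripClusterRates.TwoClusterRateIsStationaryGap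

open Filter Topology
open scoped BigOperators Classical Matrix
open Literature.Probability.Percolation Literature.Probability.LatticeModels

/-! ## Reduction to a closed block -/

/-- **Powers of a matrix on a closed block.** If the rows indexed by the image of an injection
`e : ι → P` charge only columns in that image (`T (e a) q = 0` for `q` outside), then on these rows
the powers of `T` are the powers of the block `Matrix.of ((a, b) ↦ T (e a) (e b))`. (Used for the unmarked
block of `planarTransfer S`: no unmarked → marked transition.) [folklore] -/
theorem s2a_pow_mulVec_block {P ι : Type*} [Fintype P] [DecidableEq P] [Fintype ι] [DecidableEq ι]
    (T : Matrix P P ℝ) (e : ι → P) (he : Function.Injective e)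
    (hT : ∀ (a : ι) (q : P), (∀ b, e b ≠ q) → T (e a) q = 0) (m : ℕ) :
    ∀ (f : P → ℝ) (a : ι),
      (T ^ m *ᵥ f) (e a) = ((Matrix.of fun a b => T (e a) (e b)) ^ m *ᵥ fun b => f (e b)) a := by
  induction m with
  | zero =>
    intro f a
    rw [pow_zero, pow_zero, Matrix.one_mulVec, Matrix.one_mulVec]
  | succ m ih =>
    intro f a
    rw [pow_succ, ← Matrix.mulVec_mulVec, pow_succ, ← Matrix.mulVec_mulVec, ih]
    have hvec : (fun b => (T *ᵥ f) (e b)) = ((Matrix.of fun a b => T (e a) (e b)) *ᵥ fun b => f (e b)) := by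
      funext b
      simp only [Matrix.mulVec, dotProduct, Matrix.of_apply]
      symm
      rw [← Finset.sum_image (f := fun q => T (e b) q * f q) (s := Finset.univ) (g := e)
        (fun x _ y _ h => he h)]
      refine Finset.sum_subset (Finset.subset_univ _) fun q _ hq => ?_
      rw [hT b q fun c hc => hq (Finset.mem_image.2 ⟨c, Finset.mem_univ _, hc⟩), zero_mul]
    rw [hvec]

/-! ## `alljoined ≠ free` for `n ≥ 1` -/

/-- For `n ≥ 1` the ALLJOINED pattern (all bonds open from `free`) joins the sites `0` and `1`, so
it is not the free pattern: the unmarked block has at least two states. [folklore] -/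
theorem s2a_alljoined_ne_free (n : ℕ) (hn : 1 ≤ n) :
    planarRowStep Finset.univ (hEdges (Finset.Icc (0 : ℤ) n))
        ⟨RowState.free (Finset.Icc (0 : ℤ) n), RowState.isPlanar_free (Finset.Icc (0 : ℤ) n)⟩ ≠
      ⟨RowState.free (Finset.Icc (0 : ℤ) n), RowState.isPlanar_free (Finset.Icc (0 : ℤ) n)⟩ := by
  intro h
  have h0 : (0 : ℤ) ∈ Finset.Icc (0 : ℤ) n := Finset.mem_Icc.2 ⟨le_rfl, by exact_mod_cast Nat.zero_le n⟩
  have h1 : (0 : ℤ) + 1 ∈ Finset.Icc (0 : ℤ) n := Finset.mem_Icc.2 ⟨by norm_num, by exact_mod_cast hn⟩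
  have hx : (⟨0, h0⟩ : Finset.Icc (0 : ℤ) n) ∈ hEdges (Finset.Icc (0 : ℤ) n) := (mem_hEdges _).2 h1
  have hrel : (planarRowStep Finset.univ (hEdges (Finset.Icc (0 : ℤ) n))
      ⟨RowState.free (Finset.Icc (0 : ℤ) n), RowState.isPlanar_free (Finset.Icc (0 : ℤ) n)⟩).1.rel
        (Sum.inl ⟨0, h0⟩) (Sum.inl ⟨(0 : ℤ) + 1, h1⟩) := by
    change horizRel (hEdges (Finset.Icc (0 : ℤ) n)) (vertRel Finset.univ (RowState.free _).rel)
      (Sum.inl ⟨0, h0⟩) (Sum.inl ⟨(0 : ℤ) + 1, h1⟩)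
    have hle : hEdgeRel ⟨0, h0⟩ ≤
        horizRel (hEdges (Finset.Icc (0 : ℤ) n)) (vertRel Finset.univ (RowState.free _).rel) :=
      le_trans (Finset.le_sup (f := hEdgeRel) hx) le_sup_right
    exact hle (hEdgeRel_rel _ h1)
  rw [h] at hrel
  have h01 : (Sum.inl ⟨0, h0⟩ : RowPoint (Finset.Icc (0 : ℤ) n)) = Sum.inl ⟨(0 : ℤ) + 1, h1⟩ := hrel
  have := congrArg Subtype.val (Sum.inl_injective h01)
  norm_num at this

/-! ## S2a over a general column set -/

/-- **S2a for a general column set `S`**, given `alljoined ≠ free`: the SLEM of the unmarked block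
exists (in the skeleton's inlined eigenpair language) and bounds the coupling disagreement from
above through every `s' > s`. [folklore] -/
theorem s2a_relaxationUpper_of (S : Finset ℤ)
    (hne : planarRowStep Finset.univ (hEdges S) ⟨RowState.free S, RowState.isPlanar_free S⟩ ≠
      ⟨RowState.free S, RowState.isPlanar_free S⟩) :
    ∃ s : ℝ,
      ((∃ (μ : ℂ) (v : PlanarRowState S → ℂ),
          (v ≠ 0 ∧ (∀ p, (∃ x, p.1.JoinedToStar x) → v p = 0) ∧
            ∀ p, (∀ x, ¬ p.1.JoinedToStar x) →
              ∑ q, (planarTransfer S p q : ℂ) * v q = μ * v p) ∧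
          μ ≠ 1 ∧ ‖μ‖ = s) ∧
        ∀ (μ : ℂ) (v : PlanarRowState S → ℂ),
          (v ≠ 0 ∧ (∀ p, (∃ x, p.1.JoinedToStar x) → v p = 0) ∧
            ∀ p, (∀ x, ¬ p.1.JoinedToStar x) →
              ∑ q, (planarTransfer S p q : ℂ) * v q = μ * v p) →
          μ ≠ 1 → ‖μ‖ ≤ s) ∧
      ∀ s' : ℝ, s < s' → ∃ C : ℝ, ∀ m : ℕ,
        ((((Fintype.piFinset fun _ : Fin m =>
              (Finset.univ : Finset (Finset S)) ×ˢ (hEdges S).powerset).filter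
            fun seq =>
              (List.ofFn seq).foldl (fun r OH => planarRowStep OH.1 OH.2 r)
                  (planarRowStep Finset.univ (hEdges S) ⟨RowState.free S, RowState.isPlanar_free S⟩) ≠
                (List.ofFn seq).foldl (fun r OH => planarRowStep OH.1 OH.2 r)
                  ⟨RowState.free S, RowState.isPlanar_free S⟩).card : ℝ) /
          ((2 : ℝ) ^ S.card * 2 ^ (hEdges S).card) ^ m)
        ≤ C * s' ^ m := by
  -- the unmarked block `U`, its bottom `z = free` and top `t = alljoined`
  set U : Matrix {q : PlanarRowState S // ∀ y, ¬ q.1.JoinedToStar y}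
      {q : PlanarRowState S // ∀ y, ¬ q.1.JoinedToStar y} ℝ :=
    Matrix.of fun a b => planarTransfer S a.1 b.1 with hU
  set z : {q : PlanarRowState S // ∀ y, ¬ q.1.JoinedToStar y} :=
    ⟨⟨RowState.free S, RowState.isPlanar_free S⟩, s2a_unmarked_free S⟩ with hz
  set t : {q : PlanarRowState S // ∀ y, ¬ q.1.JoinedToStar y} :=
    ⟨planarRowStep Finset.univ (hEdges S) ⟨RowState.free S, RowState.isPlanar_free S⟩,
      s2a_unmarked_rowStep _ _ _ (s2a_unmarked_free S)⟩ with ht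
  obtain ⟨s, ⟨⟨μ, g, ⟨hg0, hg⟩, hμ1, hμs⟩, hbound⟩, hrelax⟩ :=
    s2a_stochastic_relaxation_of U (fun a b => percolationRowTransfer_nonneg S _ _)
      (fun a => s2a_sum_unmarked_block a) z (fun a => s2a_planarTransfer_free_pos a.1)
      ⟨t, fun h => hne (congrArg Subtype.val h)⟩
  refine ⟨s, ⟨?_, ?_⟩, ?_⟩
  · -- existence: extend the block eigenvector by zero
    refine ⟨μ, fun q => if hq : ∀ y, ¬ q.1.JoinedToStar y then g ⟨q, hq⟩ else 0, ⟨?_, ?_, ?_⟩, hμ1, hμs⟩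
    · intro hv
      apply hg0
      funext a
      have := congrFun hv a.1
      simpa [a.2] using this
    · intro q hq
      have hq' : ¬ ∀ y, ¬ q.1.JoinedToStar y := by push Not; exact hq
      exact dif_neg hq'
    · intro p hp
      beta_reduce
      rw [dif_pos hp, ← hg ⟨p, hp⟩]
      rw [s2a_sum_eq_sum_unmarked (fun q => (planarTransfer S p q : ℂ) *
        (if hq : ∀ y, ¬ q.1.JoinedToStar y then g ⟨q, hq⟩ else 0)) ?_]
      · refine Finset.sum_congr rfl fun b _ => ?_
        simp only [hU, Matrix.of_apply, dif_pos b.2]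
      · intro q hq
        have hq' : ¬ ∀ y, ¬ q.1.JoinedToStar y := by push Not; exact hq
        simp only [dif_neg hq', mul_zero]
  · -- domination: restrict a skeleton eigenvector to the block
    rintro μ' v ⟨hv0, hvm, hv⟩ hμ'1
    refine hbound μ' (fun a => v a.1) ⟨?_, fun a => ?_⟩ hμ'1
    · intro h
      apply hv0
      funext q
      by_cases hq : ∀ y, ¬ q.1.JoinedToStar y
      · exact congrFun h ⟨q, hq⟩
      · push Not at hq
        exact hvm q hq
    · rw [← hv a.1 a.2]
      simp only [hU, Matrix.of_apply]
      exact (s2a_sum_eq_sum_unmarked (fun q => (planarTransfer S a.1 q : ℂ) * v q)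
        (fun q hq => by rw [hvm q hq, mul_zero])).symm
  · -- the relaxation bound, summed over site pairs
    intro s' hs'
    have hK : ∀ pr : S × S, ∃ K : ℝ, ∀ m : ℕ,
        (U ^ m *ᵥ fun b => if b.1.1.rel (Sum.inl pr.1) (Sum.inl pr.2) then (1 : ℝ) else 0) t -
          (U ^ m *ᵥ fun b => if b.1.1.rel (Sum.inl pr.1) (Sum.inl pr.2) then (1 : ℝ) else 0) z ≤
            K * s' ^ m := by
      intro pr
      obtain ⟨K, hK⟩ := hrelax s' hs' fun b => if b.1.1.rel (Sum.inl pr.1) (Sum.inl pr.2) then 1 else 0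
      exact ⟨K, fun m => hK m t z⟩
    choose K hK using hK
    refine ⟨∑ pr : S × S, K pr, fun m => ?_⟩
    calc _ ≤ ∑ pr : S × S,
          ((planarTransfer S ^ m *ᵥ fun q => if q.1.rel (Sum.inl pr.1) (Sum.inl pr.2) then 1 else 0) t.1 -
            (planarTransfer S ^ m *ᵥ fun q => if q.1.rel (Sum.inl pr.1) (Sum.inl pr.2) then 1 else 0)
              z.1) :=
          s2a_card_disagree_le S m t.1 z.1 (s2a_free_rel_le _) t.2
            (fun g p => s1_pow_planarTransfer_mulVec S m g p)
      _ = ∑ pr : S × S,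
          ((U ^ m *ᵥ fun b => if b.1.1.rel (Sum.inl pr.1) (Sum.inl pr.2) then (1 : ℝ) else 0) t -
            (U ^ m *ᵥ fun b => if b.1.1.rel (Sum.inl pr.1) (Sum.inl pr.2) then (1 : ℝ) else 0) z) := by
          refine Finset.sum_congr rfl fun pr _ => ?_
          have hT : ∀ (a : {q : PlanarRowState S // ∀ y, ¬ q.1.JoinedToStar y}) (q : PlanarRowState S),
              (∀ b : {q : PlanarRowState S // ∀ y, ¬ q.1.JoinedToStar y}, b.1 ≠ q) →
                planarTransfer S a.1 q = 0 := by
            intro a q hq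
            refine s2a_planarTransfer_unmarked_marked a.1 q a.2 ?_
            by_contra hq'
            push Not at hq'
            exact hq ⟨q, hq'⟩ rfl
          have h1 := s2a_pow_mulVec_block (planarTransfer S) Subtype.val Subtype.val_injective hT m
            (fun q => if q.1.rel (Sum.inl pr.1) (Sum.inl pr.2) then 1 else 0) t
          have h2 := s2a_pow_mulVec_block (planarTransfer S) Subtype.val Subtype.val_injective hT m
            (fun q => if q.1.rel (Sum.inl pr.1) (Sum.inl pr.2) then 1 else 0) z
          rw [h1, h2]
      _ ≤ ∑ pr : S × S, K pr * s' ^ m := Finset.sum_le_sum fun pr _ => hK pr m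
      _ = (∑ pr : S × S, K pr) * s' ^ m := (Finset.sum_mul _ _ _).symm

/-! ## The registered stub -/

/-- **S2a** `= RelaxationUpper` (registered stub of the line skeleton, proved): for every `n ≥ 1`
the unmarked block of `planarTransfer (Finset.Icc 0 n)` has an SLEM `s` (some unmarked eigenpair
`μ ≠ 1` with `‖μ‖ = s`, all unmarked eigenpairs `μ ≠ 1` with `‖μ‖ ≤ s`) and the coupling
disagreement satisfies `dis n m ≤ C s'^m` for every `s' > s`. [folklore] -/
theorem stub_relaxationUpper :
    ∀ n : ℕ, 1 ≤ n → ∃ s : ℝ,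
      ((∃ (μ : ℂ) (v : PlanarRowState (Finset.Icc (0 : ℤ) n) → ℂ),
          (v ≠ 0 ∧ (∀ p, (∃ x, p.1.JoinedToStar x) → v p = 0) ∧
            ∀ p, (∀ x, ¬ p.1.JoinedToStar x) →
              ∑ q, (planarTransfer (Finset.Icc (0 : ℤ) n) p q : ℂ) * v q = μ * v p) ∧
          μ ≠ 1 ∧ ‖μ‖ = s) ∧
        ∀ (μ : ℂ) (v : PlanarRowState (Finset.Icc (0 : ℤ) n) → ℂ),
          (v ≠ 0 ∧ (∀ p, (∃ x, p.1.JoinedToStar x) → v p = 0) ∧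
            ∀ p, (∀ x, ¬ p.1.JoinedToStar x) →
              ∑ q, (planarTransfer (Finset.Icc (0 : ℤ) n) p q : ℂ) * v q = μ * v p) →
          μ ≠ 1 → ‖μ‖ ≤ s) ∧
      ∀ s' : ℝ, s < s' → ∃ C : ℝ, ∀ m : ℕ,
        ((((Fintype.piFinset fun _ : Fin m =>
              (Finset.univ : Finset (Finset (Finset.Icc (0 : ℤ) n))) ×ˢ (hEdges (Finset.Icc (0 : ℤ) n)).powerset).filter
            fun seq =>
              (List.ofFn seq).foldl (fun r OH => planarRowStep OH.1 OH.2 r)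
                  (planarRowStep Finset.univ (hEdges (Finset.Icc (0 : ℤ) n))
                    ⟨RowState.free (Finset.Icc (0 : ℤ) n), RowState.isPlanar_free (Finset.Icc (0 : ℤ) n)⟩) ≠
                (List.ofFn seq).foldl (fun r OH => planarRowStep OH.1 OH.2 r)
                  ⟨RowState.free (Finset.Icc (0 : ℤ) n), RowState.isPlanar_free (Finset.Icc (0 : ℤ) n)⟩).card : ℝ) /
          ((2 : ℝ) ^ (Finset.Icc (0 : ℤ) n).card * 2 ^ (hEdges (Finset.Icc (0 : ℤ) n)).card) ^ m)
        ≤ C * s' ^ m :=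
  fun n hn => s2a_relaxationUpper_of (Finset.Icc (0 : ℤ) n) (s2a_alljoined_ne_free n hn)

end Summit.CriticalPhenomena.CardyFormulaZ2.Cruxes.StripClusterRates.TwoClusterRateIsStationaryGap

end
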